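import Summits.QuantumFields.YangMills.Theorems.ScalingWindowSplitCurvatureAmnesiaWilsonSchwingerDyson
import Literature.MathematicalPhysics.QuantumFieldTheory.Chatterjee2019LargeN.StrongCoupling
import Literature.Analysis.Matrix.DetExp
import HarnessLib

/-!
# Calculus for the `SO(N)` master loop equation: the product rule with exponential insertions, and the one-parameter subgroups `t ↦ exp(tX)` of `SO(N)` (gauge-boot, ADDENDUM 27 part M2)

HONEST FRAMING (cell `pub-gaugeboot`, page 1 of every file): the venture produces certified bounds
on lattice expectations at stated coupling, gauge group, dimension and torus size; NOT a mass gap,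
NOT a continuum limit, NOT a string tension; NOT Yang–Mills-summit-bearing (barriers
`FixedCouplingUltralocality`, `PerturbativeInvisibility`).  Matrix calculus only; nothing about a lattice theory is
claimed here.

## Content

Second file of the lane's programme on the tree's NAMED FACT `Chatterjee2019LargeN.UnsymmetrizedMasterLoopEquation`
(Chatterjee, CMP 366 (2019), Theorem 8.1).  Two tools:

* §1 `ExpFactor` — a factor `L·exp(tY)·R` of a matrix product depending on a real parameter `t`; for a LIST of such
  factors, ★ `hasDerivAt_prod_map_eval`: the derivative at `t = 0` of `Π_k L_k exp(tY_k) R_k` is the sum over the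
  positions `y` of the product with the `y`-th factor replaced by its derivative `L_y Y_y R_y` (`List.set`).  Both the
  FIRST derivative of a Wilson loop variable along the one-link flow `U_ε ↦ exp(tX) U_ε` (every letter `ε^{±1}` of the
  word is such a factor, the others are constant) and the SECOND (the derivative of a single-insertion term) are
  instances — part M3.
* §2 `soOneParam` — for a real antisymmetric `X`, `t ↦ exp(tX)` is a one-parameter subgroup of
  `SO(N) = Matrix.specialOrthogonalGroup (Fin N) ℝ` (orthogonality from `exp(Xᵀ) = (exp X)ᵀ`, determinant one from the
  tree's `det_exp_eq_exp_trace`), multiplicative in `t`, and read through Chatterjee's complexified defining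
  representation `soRep` it is `exp(t·X^ℂ)` (`soRep_soOneParam`), the hypothesis `hX` of the lane's one-link
  Schwinger–Dyson lemmas (`hasDerivAt_factor`, `IsHaarShiftState.integral_shiftDeriv_eq`).

References: S. Chatterjee, Comm. Math. Phys. 366 (2019) §§5–8; B. C. Hall, *Lie Groups, Lie Algebras, and
Representations* (2015) §2 (matrix exponential, `SO(n)`).  Everything is `[folklore]`.
-/

noncomputable section

open NormedSpace
open scoped Matrix.Norms.Frobenius Matrix
open Summit.QuantumFields.YangMills.Cruxes.CurvatureAmnesia.WardDefect.SchwingerDyson (hasDerivAt_exp_coe_smul)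
open Literature.MathematicalPhysics.QuantumFieldTheory.Chatterjee2019LargeN (SO soRep soRep_apply)

namespace Summit.QuantumFields.GaugeBoot

namespace SOMasterLoop

variable {N : ℕ}

/-! ## §1 Products of factors `L·exp(tY)·R` and their derivative at `t = 0` -/

/-- A factor `L · exp(t Y) · R` of a matrix product depending on a real parameter `t` (data `(L, Y, R)`).
[folklore] -/
structure ExpFactor (N : ℕ) where
  /-- left constant -/
  L : Matrix (Fin N) (Fin N) ℂ
  /-- generator in the exponential -/
  Y : Matrix (Fin N) (Fin N) ℂ
  /-- right constant -/
  R : Matrix (Fin N) (Fin N) ℂ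

namespace ExpFactor

/-- The value `L · exp(tY) · R` at parameter `t`. [folklore] -/
def eval (t : ℝ) (φ : ExpFactor N) : Matrix (Fin N) (Fin N) ℂ := φ.L * exp ((t : ℂ) • φ.Y) * φ.R

/-- The value `L · R` at `t = 0`. [folklore] -/
def eval₀ (φ : ExpFactor N) : Matrix (Fin N) (Fin N) ℂ := φ.L * φ.R

/-- The derivative `L · Y · R` at `t = 0`. [folklore] -/
def deriv (φ : ExpFactor N) : Matrix (Fin N) (Fin N) ℂ := φ.L * φ.Y * φ.R

/-- `eval 0 = eval₀`. [folklore] -/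
theorem eval_zero (φ : ExpFactor N) : φ.eval 0 = φ.eval₀ := by
  rw [eval, eval₀, Complex.ofReal_zero, zero_smul, exp_zero, Matrix.mul_one]

/-- A single factor is differentiable at `t = 0` with derivative `L Y R`. [folklore] -/
theorem hasDerivAt_eval (φ : ExpFactor N) : HasDerivAt (fun t : ℝ => φ.eval t) φ.deriv 0 :=
  ((hasDerivAt_exp_coe_smul φ.Y).const_mul φ.L).mul_const φ.R

end ExpFactor

/-- The derivative of `Π_k φ_k(t)` at `t = 0`, by the Leibniz rule (recursive form). [folklore] -/
def prodDeriv : List (ExpFactor N) → Matrix (Fin N) (Fin N) ℂ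
  | [] => 0
  | φ :: fs => φ.deriv * (fs.map ExpFactor.eval₀).prod + φ.eval₀ * prodDeriv fs

/-- Unfolding lemma. [folklore] -/
@[simp] theorem prodDeriv_nil : prodDeriv ([] : List (ExpFactor N)) = 0 := rfl

/-- Unfolding lemma. [folklore] -/
theorem prodDeriv_cons (φ : ExpFactor N) (fs : List (ExpFactor N)) :
    prodDeriv (φ :: fs) = φ.deriv * (fs.map ExpFactor.eval₀).prod + φ.eval₀ * prodDeriv fs := rfl

/-- At `t = 0` the product is `Π_k L_k R_k`. [folklore] -/
theorem prod_map_eval_zero (fs : List (ExpFactor N)) :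
    (fs.map (ExpFactor.eval 0)).prod = (fs.map ExpFactor.eval₀).prod := by
  congr 1
  exact List.map_congr_left fun φ _ => φ.eval_zero

/-- ★ **Product rule with exponential insertions** (recursive form): `t ↦ Π_k L_k exp(tY_k) R_k` is differentiable
at `t = 0` with derivative `prodDeriv`. [folklore] -/
theorem hasDerivAt_prod_map_eval : ∀ fs : List (ExpFactor N),
    HasDerivAt (fun t : ℝ => (fs.map (ExpFactor.eval t)).prod) (prodDeriv fs) 0
  | [] => hasDerivAt_const (0 : ℝ) (1 : Matrix (Fin N) (Fin N) ℂ)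
  | φ :: fs => by
    have hmul := φ.hasDerivAt_eval.mul (hasDerivAt_prod_map_eval fs)
    rw [ExpFactor.eval_zero, prod_map_eval_zero] at hmul
    exact hmul

/-- ★ **Product rule, positional form**: `prodDeriv` is the sum over the positions `y` of the product with the `y`-th
factor replaced by its derivative (`List.set`). [folklore] -/
theorem prodDeriv_eq_sum : ∀ fs : List (ExpFactor N),
    prodDeriv fs = ∑ y : Fin fs.length, (((fs.map ExpFactor.eval₀).set y ((fs.get y).deriv))).prod
  | [] => by simp
  | φ :: fs => by
    rw [prodDeriv_cons, prodDeriv_eq_sum fs]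
    show _ = ∑ y : Fin (fs.length + 1),
      ((((φ :: fs).map ExpFactor.eval₀).set y (((φ :: fs).get y).deriv))).prod
    rw [Fin.sum_univ_succ]
    simp only [List.map_cons, Fin.val_zero, List.set_cons_zero, List.prod_cons, Fin.val_succ, List.set_cons_succ,
      Finset.mul_sum]
    rfl

/-- The positional product rule as a statement about any function agreeing with the product (the form used by
part M3). [folklore] -/
theorem hasDerivAt_of_eq_prod_map_eval {g : ℝ → Matrix (Fin N) (Fin N) ℂ} (fs : List (ExpFactor N))
    (hg : ∀ t, g t = (fs.map (ExpFactor.eval t)).prod) :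
    HasDerivAt g (∑ y : Fin fs.length, (((fs.map ExpFactor.eval₀).set y ((fs.get y).deriv))).prod) 0 := by
  rw [← prodDeriv_eq_sum, show g = fun t => (fs.map (ExpFactor.eval t)).prod from funext hg]
  exact hasDerivAt_prod_map_eval fs

/-- The trace as an `ℝ`-linear continuous functional on complex matrices. [folklore] -/
def traceCLM (N : ℕ) : Matrix (Fin N) (Fin N) ℂ →L[ℝ] ℂ :=
  LinearMap.toContinuousLinearMap ((Matrix.traceLinearMap (Fin N) ℂ ℂ).restrictScalars ℝ)

/-- Unfolding lemma `traceCLM_apply`. [folklore] -/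
@[simp] theorem traceCLM_apply (M : Matrix (Fin N) (Fin N) ℂ) : traceCLM N M = M.trace := rfl

/-- The trace of a differentiable matrix function is differentiable, with the trace of the derivative. [folklore] -/
theorem hasDerivAt_trace {g : ℝ → Matrix (Fin N) (Fin N) ℂ} {g' : Matrix (Fin N) (Fin N) ℂ} {t : ℝ}
    (hg : HasDerivAt g g' t) : HasDerivAt (fun s => (g s).trace) g'.trace t := by
  have h := ((traceCLM N).hasFDerivAt.comp_hasDerivAt t hg).congr_deriv (traceCLM_apply g')
  exact h

/-! ## §2 One-parameter subgroups of `SO(N)` -/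

section OneParam

/-- An antisymmetric real matrix has zero trace. [folklore] -/
theorem trace_eq_zero_of_transpose_eq_neg {X : Matrix (Fin N) (Fin N) ℝ} (hX : Xᵀ = -X) : X.trace = 0 := by
  have h : X.trace = -X.trace := by
    conv_lhs => rw [← Matrix.trace_transpose X, hX, Matrix.trace_neg]
  linarith

/-- For antisymmetric `X`, `exp(tX)` is orthogonal with determinant one. [folklore] -/
theorem exp_smul_mem_specialOrthogonalGroup {X : Matrix (Fin N) (Fin N) ℝ} (hX : Xᵀ = -X) (t : ℝ) :
    exp (t • X) ∈ Matrix.specialOrthogonalGroup (Fin N) ℝ := by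
  rw [Matrix.mem_specialOrthogonalGroup_iff, Matrix.mem_orthogonalGroup_iff]
  refine ⟨?_, ?_⟩
  · rw [← Matrix.exp_transpose, Matrix.transpose_smul, hX, smul_neg,
      ← Matrix.exp_add_of_commute _ _ ((Commute.refl (t • X)).neg_right), add_neg_cancel, exp_zero]
  · rw [Literature.Analysis.Matrix.det_exp_eq_exp_trace, Matrix.trace_smul,
      trace_eq_zero_of_transpose_eq_neg hX, smul_zero, exp_zero]

/-- **The one-parameter subgroup `t ↦ exp(tX)` of `SO(N)`** generated by an antisymmetric real matrix `X`.
[folklore] -/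
def soOneParam (X : Matrix (Fin N) (Fin N) ℝ) (hX : Xᵀ = -X) (t : ℝ) : SO N :=
  ⟨exp (t • X), exp_smul_mem_specialOrthogonalGroup hX t⟩

/-- The underlying matrix of `soOneParam X t` is `exp(tX)`. [folklore] -/
@[simp] theorem coe_soOneParam {X : Matrix (Fin N) (Fin N) ℝ} (hX : Xᵀ = -X) (t : ℝ) :
    ((soOneParam X hX t : SO N) : Matrix (Fin N) (Fin N) ℝ) = exp (t • X) := rfl

/-- `exp((s+t)X) = exp(sX) exp(tX)`: the family is multiplicative (hypothesis `hk` of the lane's Schwinger–Dyson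
lemmas). [folklore] -/
theorem soOneParam_add {X : Matrix (Fin N) (Fin N) ℝ} (hX : Xᵀ = -X) (s t : ℝ) :
    soOneParam X hX (s + t) = soOneParam X hX s * soOneParam X hX t := by
  apply Subtype.ext
  change exp ((s + t) • X) = exp (s • X) * exp (t • X)
  rw [add_smul]
  exact Matrix.exp_add_of_commute _ _ (((Commute.refl X).smul_left s).smul_right t)

/-- Complexification commutes with the matrix exponential: `(exp A)^ℂ = exp(A^ℂ)`. [folklore] -/
theorem map_ofReal_exp (A : Matrix (Fin N) (Fin N) ℝ) :
    (exp A).map Complex.ofRealHom = exp (A.map Complex.ofRealHom) := by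
  have hc : Continuous (RingHom.mapMatrix (m := Fin N) Complex.ofRealHom) :=
    Continuous.matrix_map continuous_id Complex.continuous_ofReal
  exact map_exp (RingHom.mapMatrix (m := Fin N) Complex.ofRealHom) hc A

/-- **Through the defining representation, `soRep(exp(tX)) = exp(t·X^ℂ)`** (hypothesis `hX` of the lane's
Schwinger–Dyson lemmas, `X^ℂ = X.map ofReal`). [folklore] -/
theorem soRep_soOneParam {X : Matrix (Fin N) (Fin N) ℝ} (hX : Xᵀ = -X) (t : ℝ) :
    soRep N (soOneParam X hX t) = exp ((t : ℂ) • X.map Complex.ofRealHom) := by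
  rw [soRep_apply, coe_soOneParam, map_ofReal_exp]
  congr 1
  ext i j
  simp [Matrix.map_apply]

end OneParam

end SOMasterLoop

end Summit.QuantumFields.GaugeBoot
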